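import Summits.RiemannHypothesis.RiemannHypothesis.Theorems.TiltedLandingLaw421R3SinkTemplate

/-!
# TiltedLandingLaw421R3 — «SinkKernelTail» (W-08 C1 scratch, rh-idea-5 g41): the EXACT two-term expansion of the pair kernel

`farPairK u z = 1/(z − u) + 1/(z − conj u)` (#1255) satisfies the exact identity
`farPairK u z = −(1/u + 1/ū) − (1/u² + 1/ū²)·z + pairTail u z`, `pairTail u z = z²/(u²(z − u)) + z²/(ū²(z − ū))`,
with REAL leading coefficients `1/u + 1/ū = 2·Re(u⁻¹)`, `1/u² + 1/ū² = 2·Re((u²)⁻¹)` and the tail bound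
`‖pairTail u z‖ ≤ ‖z‖²/(‖u‖²·‖z − u‖) + ‖z‖²/(‖u‖²·‖z − ū‖)`.
Consequences (the «LIMIT LAW + REMAINDER» shape, (CA1134)/C3 RESULT-5): `farPairC w u = 2·Re((u²)⁻¹)·Im w − Im (pairTail u w)` and
`farPairK u w − farPairK u p = −(1/u² + 1/ū²)·(w − p) + (pairTail u w − pairTail u p)`.
Pure algebra about points of ℂ; no `f`, no law. Sorry-free.
-/

namespace RhW08.SinkThin

open Complex
open scoped ComplexConjugate
open RhW08.SinkTemplate

section KernelTail

/-- The exact remainder of the two-term expansion of the pair kernel at `z = 0`. -/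
noncomputable def pairTail (u z : ℂ) : ℂ := z ^ 2 / (u ^ 2 * (z - u)) + z ^ 2 / ((conj u) ^ 2 * (z - conj u))

/-- One pole, expanded to second order exactly: `1/(z − u) = −1/u − z/u² + z²/(u²(z − u))`. -/
theorem one_div_sub_expand (u z : ℂ) (hu : u ≠ 0) (hz : z ≠ u) :
    1 / (z - u) = -(1 / u) - (1 / u ^ 2) * z + z ^ 2 / (u ^ 2 * (z - u)) := by
  have hzu : z - u ≠ 0 := sub_ne_zero.mpr hz
  have hu2 : u ^ 2 ≠ 0 := pow_ne_zero 2 hu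
  field_simp
  ring

/-- EXACT two-term expansion: `K_u(z) = −(1/u + 1/ū) − (1/u² + 1/ū²)·z + pairTail u z`. -/
theorem farPairK_expand (u z : ℂ) (hu : u ≠ 0) (hz : z ≠ u) (hz' : z ≠ conj u) :
    farPairK u z = -(1 / u + 1 / conj u) - (1 / u ^ 2 + 1 / (conj u) ^ 2) * z + pairTail u z := by
  have hcu : conj u ≠ 0 := by
    intro h; apply hu; simpa using congrArg conj h
  unfold farPairK pairTail
  rw [one_div_sub_expand u z hu hz, one_div_sub_expand (conj u) z hcu hz']
  ring

/-- The constant coefficient is real: `1/u + 1/ū = 2·Re(u⁻¹)`. -/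
theorem one_div_add_one_div_conj (u : ℂ) : 1 / u + 1 / conj u = ((2 * (u⁻¹).re : ℝ) : ℂ) := by
  rw [one_div, one_div, ← map_inv₀, Complex.add_conj]

/-- The linear coefficient is real: `1/u² + 1/ū² = 2·Re((u²)⁻¹)`. -/
theorem one_div_sq_add_one_div_conj_sq (u : ℂ) : 1 / u ^ 2 + 1 / (conj u) ^ 2 = ((2 * ((u ^ 2)⁻¹).re : ℝ) : ℂ) := by
  rw [← map_pow, one_div, one_div, ← map_inv₀, Complex.add_conj]

/-- TAIL BOUND: `‖pairTail u z‖ ≤ ‖z‖²/(‖u‖²‖z − u‖) + ‖z‖²/(‖u‖²‖z − ū‖)`. -/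
theorem norm_pairTail_le (u z : ℂ) :
    ‖pairTail u z‖ ≤ ‖z‖ ^ 2 / (‖u‖ ^ 2 * ‖z - u‖) + ‖z‖ ^ 2 / (‖u‖ ^ 2 * ‖z - conj u‖) := by
  unfold pairTail
  have h1 : ‖z ^ 2 / (u ^ 2 * (z - u))‖ = ‖z‖ ^ 2 / (‖u‖ ^ 2 * ‖z - u‖) := by
    rw [norm_div, norm_mul, norm_pow, norm_pow]
  have h2 : ‖z ^ 2 / ((conj u) ^ 2 * (z - conj u))‖ = ‖z‖ ^ 2 / (‖u‖ ^ 2 * ‖z - conj u‖) := by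
    rw [norm_div, norm_mul, norm_pow, norm_pow, Complex.norm_conj]
  exact (norm_add_le _ _).trans (by rw [h1, h2])

/-- LEADING FORM of `c(u)`: `farPairC w u = 2·Re((u²)⁻¹)·Im w − Im (pairTail u w)`. -/
theorem farPairC_expand (w u : ℂ) (hu : u ≠ 0) (hw : w ≠ u) (hw' : w ≠ conj u) :
    farPairC w u = 2 * ((u ^ 2)⁻¹).re * w.im - (pairTail u w).im := by
  unfold farPairC
  rw [farPairK_expand u w hu hw hw', one_div_add_one_div_conj, one_div_sq_add_one_div_conj_sq]
  simp only [Complex.add_im, Complex.sub_im, Complex.neg_im, Complex.mul_im, Complex.ofReal_im, Complex.ofReal_re,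
    zero_mul, add_zero, neg_zero]
  ring

/-- LEADING FORM of a kernel DIFFERENCE (the foot read's numerator): `K_u(w) − K_u(p) = −(1/u² + 1/ū²)(w − p) + (tails)`. -/
theorem farPairK_sub_expand (u w p : ℂ) (hu : u ≠ 0) (hw : w ≠ u) (hw' : w ≠ conj u) (hp : p ≠ u) (hp' : p ≠ conj u) :
    farPairK u w - farPairK u p = -(1 / u ^ 2 + 1 / (conj u) ^ 2) * (w - p) + (pairTail u w - pairTail u p) := by
  rw [farPairK_expand u w hu hw hw', farPairK_expand u p hu hp hp']
  ring

/-- The leading coefficient in closed form: `Re((u²)⁻¹) = (Re u² − Im u²)/normSq u²` — POSITIVE on the thin boundary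
(`|Re u − xv| ≥ R/2 > Hs ≥ |Im u|` after translating `xv` to `0`). -/
theorem inv_sq_re (u : ℂ) : ((u ^ 2)⁻¹).re = (u.re ^ 2 - u.im ^ 2) / (Complex.normSq u) ^ 2 := by
  rw [Complex.inv_re, map_pow]
  congr 1
  rw [sq, Complex.mul_re]
  ring

/-- Positivity of the leading coefficient off the diagonals: `|Im u| < |Re u| → 0 < Re((u²)⁻¹)`. -/
theorem inv_sq_re_pos (u : ℂ) (h : |u.im| < |u.re|) : 0 < ((u ^ 2)⁻¹).re := by
  rw [inv_sq_re]
  have hu : u ≠ 0 := by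
    intro h0; rw [h0] at h; simp at h
  have hn : 0 < Complex.normSq u := Complex.normSq_pos.mpr hu
  apply div_pos _ (pow_pos hn 2)
  have := sq_lt_sq' (by linarith [abs_nonneg u.im, neg_abs_le u.im, abs_lt.mp (lt_of_le_of_lt (le_refl _) h) |>.1]) (abs_lt.mp h).2
  nlinarith [sq_abs u.im, sq_abs u.re, abs_nonneg u.im, abs_nonneg u.re, mul_self_lt_mul_self (abs_nonneg u.im) h]

/-- FAR TAIL BOUND: for `‖z‖ ≤ ρ` and `‖u‖ ≥ 2ρ > 0`, `‖pairTail u z‖ ≤ 4ρ²/‖u‖³`. -/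
theorem norm_pairTail_le_of_far (u z : ℂ) (ρ : ℝ) (hρ : 0 < ρ) (hz : ‖z‖ ≤ ρ) (hu : 2 * ρ ≤ ‖u‖) :
    ‖pairTail u z‖ ≤ 4 * ρ ^ 2 / ‖u‖ ^ 3 := by
  have hu0 : 0 < ‖u‖ := by linarith
  have hzu : ‖u‖ / 2 ≤ ‖z - u‖ := by
    have := norm_sub_norm_le u z
    rw [norm_sub_rev] at this
    linarith
  have hzu' : ‖u‖ / 2 ≤ ‖z - conj u‖ := by
    have := norm_sub_norm_le (conj u) z
    rw [norm_sub_rev, Complex.norm_conj] at this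
    linarith
  have h1 : ‖z‖ ^ 2 / (‖u‖ ^ 2 * ‖z - u‖) ≤ 2 * ρ ^ 2 / ‖u‖ ^ 3 := by
    rw [div_le_div_iff₀ (mul_pos (pow_pos hu0 2) (lt_of_lt_of_le (by positivity) hzu)) (by positivity)]
    have hz2 : ‖z‖ ^ 2 ≤ ρ ^ 2 := pow_le_pow_left₀ (norm_nonneg _) hz 2
    calc ‖z‖ ^ 2 * ‖u‖ ^ 3 ≤ ρ ^ 2 * ‖u‖ ^ 3 := by gcongr
      _ = 2 * ρ ^ 2 * (‖u‖ ^ 2 * (‖u‖ / 2)) := by ring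
      _ ≤ 2 * ρ ^ 2 * (‖u‖ ^ 2 * ‖z - u‖) := by gcongr
  have h2 : ‖z‖ ^ 2 / (‖u‖ ^ 2 * ‖z - conj u‖) ≤ 2 * ρ ^ 2 / ‖u‖ ^ 3 := by
    rw [div_le_div_iff₀ (mul_pos (pow_pos hu0 2) (lt_of_lt_of_le (by positivity) hzu')) (by positivity)]
    have hz2 : ‖z‖ ^ 2 ≤ ρ ^ 2 := pow_le_pow_left₀ (norm_nonneg _) hz 2
    calc ‖z‖ ^ 2 * ‖u‖ ^ 3 ≤ ρ ^ 2 * ‖u‖ ^ 3 := by gcongr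
      _ = 2 * ρ ^ 2 * (‖u‖ ^ 2 * (‖u‖ / 2)) := by ring
      _ ≤ 2 * ρ ^ 2 * (‖u‖ ^ 2 * ‖z - conj u‖) := by gcongr
  calc ‖pairTail u z‖ ≤ _ := norm_pairTail_le u z
    _ ≤ 2 * ρ ^ 2 / ‖u‖ ^ 3 + 2 * ρ ^ 2 / ‖u‖ ^ 3 := add_le_add h1 h2
    _ = 4 * ρ ^ 2 / ‖u‖ ^ 3 := by ring

/-- EXACT FACTORISATION of a kernel difference (C3's `K_u(w) − K_u(p) = δ·M(u)` with `δ = w − p`):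
`K_u(w) − K_u(p) = −(w − p)·(1/((w − u)(p − u)) + 1/((w − ū)(p − ū)))`. -/
theorem farPairK_sub_eq (u w p : ℂ) (hw : w ≠ u) (hw' : w ≠ conj u) (hp : p ≠ u) (hp' : p ≠ conj u) :
    farPairK u w - farPairK u p = -(w - p) * (1 / ((w - u) * (p - u)) + 1 / ((w - conj u) * (p - conj u))) := by
  have h1 : w - u ≠ 0 := sub_ne_zero.mpr hw
  have h2 : w - conj u ≠ 0 := sub_ne_zero.mpr hw'
  have h3 : p - u ≠ 0 := sub_ne_zero.mpr hp
  have h4 : p - conj u ≠ 0 := sub_ne_zero.mpr hp'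
  unfold farPairK
  field_simp
  ring

/-- The exact remainder of the product factor: `1/((w − u)(p − u)) = 1/u² + pairTail₂-summand`. -/
noncomputable def pairTail2 (u w p : ℂ) : ℂ :=
  (u * (w + p) - w * p) / (u ^ 2 * ((w - u) * (p - u))) + (conj u * (w + p) - w * p) / ((conj u) ^ 2 * ((w - conj u) * (p - conj u)))

/-- One product of poles, expanded to leading order exactly: `1/((w − u)(p − u)) = 1/u² + (u(w + p) − wp)/(u²(w − u)(p − u))`. -/
theorem one_div_mul_expand (u w p : ℂ) (hu : u ≠ 0) (hw : w ≠ u) (hp : p ≠ u) :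
    1 / ((w - u) * (p - u)) = 1 / u ^ 2 + (u * (w + p) - w * p) / (u ^ 2 * ((w - u) * (p - u))) := by
  have h1 : w - u ≠ 0 := sub_ne_zero.mpr hw
  have h3 : p - u ≠ 0 := sub_ne_zero.mpr hp
  have hu2 : u ^ 2 ≠ 0 := pow_ne_zero 2 hu
  field_simp
  ring

/-- EXACT expansion of the difference factor: `1/((w−u)(p−u)) + 1/((w−ū)(p−ū)) = (1/u² + 1/ū²) + pairTail2 u w p`, so that
`K_u(w) − K_u(p) = −(w − p)·(2·Re((u²)⁻¹) + pairTail2 u w p)` — the foot read's numerator is `δ` times a REAL leading term plus tail. -/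
theorem farPairK_sub_expand2 (u w p : ℂ) (hu : u ≠ 0) (hw : w ≠ u) (hw' : w ≠ conj u) (hp : p ≠ u) (hp' : p ≠ conj u) :
    farPairK u w - farPairK u p = -(w - p) * (((2 * ((u ^ 2)⁻¹).re : ℝ) : ℂ) + pairTail2 u w p) := by
  have hcu : conj u ≠ 0 := by
    intro h; apply hu; simpa using congrArg conj h
  rw [farPairK_sub_eq u w p hw hw' hp hp', ← one_div_sq_add_one_div_conj_sq, one_div_mul_expand u w p hu hw hp,
    one_div_mul_expand (conj u) w p hcu hw' hp']
  unfold pairTail2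
  ring

/-- FAR BOUND for the difference tail: `‖w‖, ‖p‖ ≤ ρ`, `‖u‖ ≥ 2ρ > 0` ⇒ `‖pairTail2 u w p‖ ≤ 20ρ/‖u‖³`. -/
theorem norm_pairTail2_le_of_far (u w p : ℂ) (ρ : ℝ) (hρ : 0 < ρ) (hw : ‖w‖ ≤ ρ) (hp : ‖p‖ ≤ ρ) (hu : 2 * ρ ≤ ‖u‖) :
    ‖pairTail2 u w p‖ ≤ 20 * ρ / ‖u‖ ^ 3 := by
  have hu0 : 0 < ‖u‖ := by linarith
  have far : ∀ z c : ℂ, ‖z‖ ≤ ρ → ‖c‖ = ‖u‖ → ‖u‖ / 2 ≤ ‖z - c‖ := by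
    intro z c hz hc
    have := norm_sub_norm_le c z
    rw [norm_sub_rev, hc] at this
    linarith
  have num : ∀ c : ℂ, ‖c‖ = ‖u‖ → ‖c * (w + p) - w * p‖ ≤ 5 / 2 * ρ * ‖u‖ := by
    intro c hc
    calc ‖c * (w + p) - w * p‖ ≤ ‖c * (w + p)‖ + ‖w * p‖ := norm_sub_le _ _
      _ = ‖c‖ * ‖w + p‖ + ‖w‖ * ‖p‖ := by rw [norm_mul, norm_mul]
      _ ≤ ‖u‖ * (ρ + ρ) + ρ * ρ := by
          rw [hc]; gcongr; exact (norm_add_le _ _).trans (add_le_add hw hp)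
      _ ≤ 5 / 2 * ρ * ‖u‖ := by nlinarith
  have term : ∀ c : ℂ, ‖c‖ = ‖u‖ →
      ‖(c * (w + p) - w * p) / (c ^ 2 * ((w - c) * (p - c)))‖ ≤ 10 * ρ / ‖u‖ ^ 3 := by
    intro c hc
    have hwc := far w c hw hc
    have hpc := far p c hp hc
    have hden : ‖u‖ ^ 2 * (‖u‖ / 2 * (‖u‖ / 2)) ≤ ‖c ^ 2 * ((w - c) * (p - c))‖ := by
      rw [norm_mul, norm_mul, norm_pow, hc]; gcongr
    have hden0 : 0 < ‖c ^ 2 * ((w - c) * (p - c))‖ := lt_of_lt_of_le (by positivity) hden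
    rw [norm_div, div_le_div_iff₀ hden0 (by positivity)]
    calc ‖c * (w + p) - w * p‖ * ‖u‖ ^ 3 ≤ 5 / 2 * ρ * ‖u‖ * ‖u‖ ^ 3 := by gcongr; exact num c hc
      _ = 10 * ρ * (‖u‖ ^ 2 * (‖u‖ / 2 * (‖u‖ / 2))) := by ring
      _ ≤ 10 * ρ * ‖c ^ 2 * ((w - c) * (p - c))‖ := by gcongr
  unfold pairTail2
  calc _ ≤ ‖(u * (w + p) - w * p) / (u ^ 2 * ((w - u) * (p - u)))‖
        + ‖(conj u * (w + p) - w * p) / ((conj u) ^ 2 * ((w - conj u) * (p - conj u)))‖ := norm_add_le _ _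
    _ ≤ 10 * ρ / ‖u‖ ^ 3 + 10 * ρ / ‖u‖ ^ 3 := add_le_add (term u rfl) (term (conj u) (Complex.norm_conj u))
    _ = 20 * ρ / ‖u‖ ^ 3 := by ring

/-- The pair kernel is REAL at real arguments: `Im K_u(x) = 0` for `x : ℝ`. -/
theorem farPairK_ofReal_im (u : ℂ) (x : ℝ) : (farPairK u (x : ℂ)).im = 0 := by
  have h : farPairK u (x : ℂ) = conj (farPairK u (x : ℂ)) := by
    unfold farPairK
    simp only [map_add, map_div₀, map_one, map_sub, Complex.conj_ofReal, Complex.conj_conj]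
    ring
  have := congrArg Complex.im h
  rw [Complex.conj_im] at this
  linarith

/-- «t CANCELS»: `c(u) = Im w · Re (1/((w − u)(Re w − u)) + 1/((w − ū)(Re w − ū)))` — EXACT (from `farPairK_sub_eq` with `p = Re w`,
`w − p = i·Im w`, and `Im K_u(Re w) = 0`). So `c(u)/t` is a regular function of the datum down to `t = 0`. -/
theorem farPairC_eq_im_mul (w u : ℂ) (hw : w ≠ u) (hw' : w ≠ conj u) (hx : (w.re : ℂ) ≠ u) (hx' : (w.re : ℂ) ≠ conj u) :
    farPairC w u = w.im * (1 / ((w - u) * ((w.re : ℂ) - u)) + 1 / ((w - conj u) * ((w.re : ℂ) - conj u))).re := by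
  have hsub := farPairK_sub_eq u w (w.re : ℂ) hw hw' hx hx'
  have hwp : w - (w.re : ℂ) = (w.im : ℂ) * Complex.I := by
    apply Complex.ext <;> simp
  have hK : farPairK u w = farPairK u (w.re : ℂ) - (w.im : ℂ) * Complex.I
      * (1 / ((w - u) * ((w.re : ℂ) - u)) + 1 / ((w - conj u) * ((w.re : ℂ) - conj u))) := by
    rw [← hwp]; linear_combination hsub
  unfold farPairC
  rw [hK, Complex.sub_im, farPairK_ofReal_im, Complex.mul_im, Complex.mul_re, Complex.mul_im, Complex.ofReal_re,
    Complex.ofReal_im, Complex.I_re, Complex.I_im]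
  ring

/-- LEADING FORM of `c(u)/t`: `c(u) = Im w · (2·Re((u²)⁻¹) + Re (pairTail2 u w (Re w)))`, remainder `‖pairTail2‖ ≤ 20ρ/‖u‖³` far out
(`norm_pairTail2_le_of_far`) — uniformly in `t = Im w`. -/
theorem farPairC_expand2 (w u : ℂ) (hu : u ≠ 0) (hw : w ≠ u) (hw' : w ≠ conj u) (hx : (w.re : ℂ) ≠ u) (hx' : (w.re : ℂ) ≠ conj u) :
    farPairC w u = w.im * (2 * ((u ^ 2)⁻¹).re + (pairTail2 u w (w.re : ℂ)).re) := by
  have hcu : conj u ≠ 0 := by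
    intro h; apply hu; simpa using congrArg conj h
  rw [farPairC_eq_im_mul w u hw hw' hx hx', one_div_mul_expand u w _ hu hw hx, one_div_mul_expand (conj u) w _ hcu hw' hx',
    show (1 / u ^ 2 + (u * (w + ↑w.re) - w * ↑w.re) / (u ^ 2 * ((w - u) * (↑w.re - u))) +
        (1 / (conj u) ^ 2 + (conj u * (w + ↑w.re) - w * ↑w.re) / ((conj u) ^ 2 * ((w - conj u) * (↑w.re - conj u)))))
        = (1 / u ^ 2 + 1 / (conj u) ^ 2) + pairTail2 u w (w.re : ℂ) by unfold pairTail2; ring,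
    one_div_sq_add_one_div_conj_sq, Complex.add_re, Complex.ofReal_re]

/-- «δ CANCELS» for the foot read: with `p₀ = w − δ` (`δ : ℝ`), `K_u(w) − K_u(p₀) = −δ·(2·Re((u²)⁻¹) + pairTail2 u w p₀)` — the foot-read
numerator over `δ` is regular down to `δ = 0` (restating `farPairK_sub_expand2` in the foot-read variables). -/
theorem farPairK_sub_foot (u w : ℂ) (δ : ℝ) (hu : u ≠ 0) (hw : w ≠ u) (hw' : w ≠ conj u) (hp : w - δ ≠ u) (hp' : w - δ ≠ conj u) :
    farPairK u w - farPairK u (w - δ) = -(δ : ℂ) * (((2 * ((u ^ 2)⁻¹).re : ℝ) : ℂ) + pairTail2 u w (w - δ)) := by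
  rw [farPairK_sub_expand2 u w (w - δ) hu hw hw' hp hp']
  ring

end KernelTail

end RhW08.SinkThin
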